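import Mathlib
import HarnessLib
import Summits.HubbardSuperconductivity.HubbardSuperconductivity.Theorems.WeakCouplingBCSKlCertTPrimeConvexHS
import Summits.HubbardSuperconductivity.HubbardSuperconductivity.Theorems.WeakCouplingBCSKlCertTPrimePocketAnalyticHS
import Summits.HubbardSuperconductivity.HubbardSuperconductivity.Theorems.WeakCouplingBCSKlCertTPrimeJoint

/-!
# Route `WeakCouplingBCS` — certificate half of stmt-HubbardSuperconductivity-0158, item «CONVEX-WINDOW-HS», file S4:
# ANY ACCEPTED M-SIDE `t′` CERTIFICATE LANDS MODULO ITS ENCLOSURES BY ONE LEMMA — the analytic side `KLTPAnalytic` on the convex hole-pocket window is a theorem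

Cell `gate-hubbard-kl`, seat p4 (g24); zero kit; no definitions.  ✓ `kltp_pocket_analytic_of_HS` (p4 g23) gives `KLTPAnalytic (squareDispersion 1 t′) μ` on the
hole-pocket window `−1/2 < t′ < 0`, `4t′ < μ < 0`, `(1 − t′μ)(1 + 4t′²) ≤ (1 − 4t′²)(1 − 2t′)` from the Hilbert–Schmidt row ALONE; ✓ `kltp_HS_Mside` (S2) supplies that row on
the convexity band `μ − 4t′ < 32|t′|(1 − 4t′²)`.  Hence:

* **`kltp_analytic_Mside`** — `KLTPAnalytic (squareDispersion 1 tp) μ` at every such `(t′, μ)`, NO analytic hypothesis left;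
* **`kltp_window_U_of_E (tp) (c) (hc : c.checkB1gD = true) (htp1) (htp2) (hwin) (hE : c.EnclosuresB1gTP tp)`** — any kernel-checked `t′` record `c` whose boxes lie
  in that window concludes `KLB1gDominatesTP tp mub mua gamma` MODULO ITS CERTIFIED ENCLOSURES `hE` ONLY (✓ `kltp_window_U`);
* **`kltpj_window_U_of_E`** — the same for JOINT certificates (✓ `KlCertTPrimeJoint.kltpj_window_U`).

So a future `(δ, t′)` record on the M side needs, besides its `decide` certificate and its enclosures, only the four window inequalities per box by `norm_num` —
exactly the standing of the `t′ = 0` records and of the `(⅛, −0.3)` records (F4).  HONEST LABEL: no record is created or decided here (KIT FREEZE); records stay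
RECORD-class, conditional on their certified enclosures; nothing DECIDED moves; nothing about `K₃`, `U₀`, the window or superconductivity; a Kohn–Luttinger
`O(U²)` channel statement is not ODLRO; nothing here proves superconductivity in the Hubbard model.
References: S. Raghu, S. A. Kivelson, D. J. Scalapino, Phys. Rev. B 81 (2010) 224505, §II (5)–(8), (13), §III Fig. 3.
-/

noncomputable section

-- the tree's namespace `Summit.<Summit>.<Problem>.Theorems` repeats the summit name by design (D-0017)
set_option linter.dupNamespace false

namespace Summit.HubbardSuperconductivity.HubbardSuperconductivity.Theorems

open Real Set Filter MeasureTheory Literature.MathematicalPhysics.QuantumLattice KlTPrimeConvexity KlCertTPrimeJoint CwKLChiralWindow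
open scoped Topology ENNReal

/-- **The analytic side of a hole-pocket row is a THEOREM on the convex window**: for `−1/2 < t′ < 0`, `4t′ < μ < 0`,
`(1 − t′μ)(1 + 4t′²) ≤ (1 − 4t′²)(1 − 2t′)` and `μ − 4t′ < 32|t′|(1 − 4t′²)`, `KLTPAnalytic (squareDispersion 1 t′) μ` holds (finite measure, `D₄` rows,
channel states ✓ `kltp_pocket_analytic_of_HS`; Hilbert–Schmidt row ✓ `kltp_HS_Mside`). [cite: RaghuKivelsonScalapino2010, §II (5)-(8)] -/
theorem kltp_analytic_Mside {tp μ : ℝ} (htp1 : -1 / 2 < tp) (htp2 : tp < 0) (hμ1 : 4 * tp < μ) (hμ2 : μ < 0)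
    (hH : (1 - tp * μ) * (1 + 4 * tp ^ 2) ≤ (1 - 4 * tp ^ 2) * (1 - 2 * tp)) (hdisc : μ - 4 * tp < 32 * |tp| * (1 - 4 * tp ^ 2)) :
    KLTPAnalytic (squareDispersion 1 tp) μ :=
  kltp_pocket_analytic_of_HS htp1 htp2 hμ1 hμ2 hH (kltp_HS_Mside htp1 htp2 hμ1 (by linarith) hdisc)

/-- **ANY ACCEPTED M-SIDE `t′` RECORD LANDS MODULO ITS ENCLOSURES**: a kernel-checked certificate `c` (`c.checkB1gD = true`) whose boxes lie in the convex
hole-pocket window gives `KLB1gDominatesTP t′ mub mua γ` from its certified enclosures `hE` ALONE. [cite: RaghuKivelsonScalapino2010, §III Fig. 3] -/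
theorem kltp_window_U_of_E (tp : ℝ) (c : KLCert) (hc : c.checkB1gD = true) (htp1 : -1 / 2 < tp) (htp2 : tp < 0)
    (hwin : ∀ bx ∈ c.boxes, ∀ μ ∈ Set.Icc (bx.mulo : ℝ) (bx.muhi : ℝ),
      4 * tp < μ ∧ μ < 0 ∧ (1 - tp * μ) * (1 + 4 * tp ^ 2) ≤ (1 - 4 * tp ^ 2) * (1 - 2 * tp) ∧ μ - 4 * tp < 32 * |tp| * (1 - 4 * tp ^ 2))
    (hE : c.EnclosuresB1gTP tp) :
    KLB1gDominatesTP tp ((c.mub : ℚ) : ℝ) ((c.mua : ℚ) : ℝ) ((c.gamma : ℚ) : ℝ) :=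
  kltp_window_U tp c hc (fun bx hbx μ hμ =>
    kltp_analytic_Mside htp1 htp2 (hwin bx hbx μ hμ).1 (hwin bx hbx μ hμ).2.1 (hwin bx hbx μ hμ).2.2.1 (hwin bx hbx μ hμ).2.2.2) hE

/-- **The same for JOINT certificates**: a kernel-checked joint certificate (`checkB1gJ c rows γ = true`) whose boxes lie in the convex hole-pocket window gives
`KLB1gDominatesTP t′ mub mua γ` from its joint enclosures `hE` ALONE. [cite: RaghuKivelsonScalapino2010, §III Fig. 3] -/
theorem kltpj_window_U_of_E (tp : ℝ) (c : KLCert) (rows : List KLJRow) (γ : ℚ) (hc : checkB1gJ c rows γ = true) (htp1 : -1 / 2 < tp) (htp2 : tp < 0)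
    (hwin : ∀ bx ∈ c.boxes, ∀ μ ∈ Set.Icc (bx.mulo : ℝ) (bx.muhi : ℝ),
      4 * tp < μ ∧ μ < 0 ∧ (1 - tp * μ) * (1 + 4 * tp ^ 2) ≤ (1 - 4 * tp ^ 2) * (1 - 2 * tp) ∧ μ - 4 * tp < 32 * |tp| * (1 - 4 * tp ^ 2))
    (hE : JointEnclosuresB1gTP c rows tp) :
    KLB1gDominatesTP tp ((c.mub : ℚ) : ℝ) ((c.mua : ℚ) : ℝ) ((γ : ℚ) : ℝ) :=
  kltpj_window_U tp c rows γ hc (fun bx hbx μ hμ =>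
    kltp_analytic_Mside htp1 htp2 (hwin bx hbx μ hμ).1 (hwin bx hbx μ hμ).2.1 (hwin bx hbx μ hμ).2.2.1 (hwin bx hbx μ hμ).2.2.2) hE

end Summit.HubbardSuperconductivity.HubbardSuperconductivity.Theorems

end
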